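import Summits.BirchSwinnertonDyer.BirchSwinnertonDyer.Theorems.ManinLocalTwoThreeCongruenceHomShiftInvariant
import Summits.BirchSwinnertonDyer.BirchSwinnertonDyer.Theorems.ManinLocalTwoThreeShiftInvariantHeckeEigenvalue
import HarnessLib

/-!
# LEMMA C (E-es-39 `HeckeOnCongruenceCharacter`): `T_r c = (r + 1)·c` for a homomorphism `c : Γ₀(L) → K` killing
# `Γ₀(L) ∩ Γ(t^M)` and a prime `r ≡ 1 (mod t^M)`

Summit `BirchSwinnertonDyer`, route `ManinLocalTwoThree` (cell bsd-f2-manin), deciding crux C2 `ManinOddAtFour`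
(stmt-BirchSwinnertonDyer-22967), skeleton line `kato_shift_two` (v5, `Cruxes/ManinOddAtFour/Lines/kato_shift_two.lean`),
stub 3 `stub_cThreeImageResidual` (the 3 950 `C₃`-image classes).  The es planner's line for that stub (MEMO-es §25,
HOME/es/Sketch-es-g12.lean: Bass–Serre / Wiles-Lemma-2.5 descent under the `t`-power non-Eisenstein hypothesis hNT) uses at
every step its LEMMA C, E-es-39 `EsG12.HeckeOnCongruenceCharacter t`: a `t^M`-congruence character is an EXACT
`T_r`-eigenvector with eigenvalue `r + 1` for every prime `r ∤ tL`, `r ≡ 1 (mod t^M)`.  This file proves it, with the body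
of the sketch's definition VERBATIM as the statement (`heckeOnCongruenceCharacter`), from the tree's Hecke data
(`heckePermElt_spec`: `γ'ᵢ β_{σ(i)} = βᵢ γ`): modulo `t^M` the representatives `βⱼ = (1 j; 0 r)`, `β_∞ = (r 0; 0 1)` ARE the
unipotents `U_j = T^j`, `U_∞ = 1` (as `r ≡ 1`), so `γ'ᵢ ≡ Uᵢ γ U_{σ(i)}⁻¹ (mod t^M)`, hence
`c(γ'ᵢ) = c(Uᵢ) + c(γ) − c(U_{σ(i)})` (`congr_of_kills_principalCongruence`, p1) and the unipotent terms cancel in the sum over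
the `r + 1` indices (`σ` is a bijection).  General commutative coefficient ring (`heckeU_eq_smul_of_kills_powCongruence`).
No new definitions; nothing about BSD or Manin's conjecture is proved here.

References: G. Shimura (1971) §8.3 (8.3.2); A. Wiles, Ann. of Math. 141 (1995) Lemma 2.5 («T_l − 1 − l for
l ≡ 1 mod Nq^{r+1} is nilpotent»); cell memo HOME/MEMO-es.md §25.2–25.3 (C).
-/

set_option autoImplicit false
set_option linter.dupNamespace false

open scoped MatrixGroups

open CongruenceSubgroup Matrix.SpecialLinearGroup ModularGroup Literature.NumberTheory.EllipticCurves.ModularForms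
  Literature.NumberTheory.EllipticCurves.ModularForms.HidaCohomology

namespace Summit.BirchSwinnertonDyer.BirchSwinnertonDyer.Theorems.ManinLocalTwoThree

section LemmaC

variable {L : ℕ} {K : Type*} [CommRing K] {r : ℕ} [NeZero r] (hr : r.Prime)

/-- Powers of `T` lie in every `Γ₀(L)`. [folklore] -/
theorem T_zpow_mem_Gamma0 (L : ℕ) (m : ℤ) : (T ^ m : SL(2, ℤ)) ∈ Gamma0 L := by
  rw [Gamma0_mem, coe_T_zpow]
  simp

/-- **Reduction of the Hecke representatives modulo `n` when `r ≡ 1 (mod n)`**: `βⱼ ≡ T^j`, `β_∞ ≡ 1` entrywise — the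
representatives are congruent to the unipotents `U_o = Option.elim o 1 (j ↦ T^j) ∈ Γ₀(L)`. [cite: DiamondShurman2005, §5.2 (5.2)] -/
theorem heckeRep_map_eq_of_modEq (L : ℕ) {n : ℕ} (hrn : r ≡ 1 [MOD n]) (o : Option (ZMod r)) :
    (heckeRep r o).map (Int.castRingHom (ZMod n)) =
      (gmat (Option.elim o (1 : Gamma0 L) fun j ↦ ⟨T ^ (j.val : ℤ), T_zpow_mem_Gamma0 L _⟩)).map
        (Int.castRingHom (ZMod n)) := by
  have hr1 : (r : ZMod n) = 1 := by
    rw [← Nat.cast_one]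
    exact (ZMod.natCast_eq_natCast_iff r 1 n).mpr hrn
  cases o with
  | none =>
    simp only [Option.elim, gmat_one]
    ext i j
    fin_cases i <;> fin_cases j <;> simp [heckeRep, hr1]
  | some j =>
    simp only [Option.elim, gmat]
    rw [coe_T_zpow]
    ext i k
    fin_cases i <;> fin_cases k <;> simp [heckeRep, hr1]

/-- **LEMMA C (E-es-39), general coefficients.**  Let `c : Γ₀(L) → K` be additive and kill every element of `Γ₀(L)`
congruent to `1` modulo `n`, and let `r ∤ L` be a prime with `r ≡ 1 (mod n)`.  Then `T_r c = (r + 1)·c` exactly.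
Proof: `γ'ᵢ ≡ Uᵢ γ U_{σ(i)}⁻¹ (mod n)`, so `c(γ'ᵢ) = c(Uᵢ) + c(γ) − c(U_{σ(i)})`, and `Σᵢ c(Uᵢ) = Σᵢ c(U_{σ(i)})`.
[cite: Shimura1971, §8.3 (8.3.2)] -/
theorem heckeU_eq_smul_of_kills_congruence {n : ℕ} [NeZero n] {c : Gamma0 L → Fin 1 → K} (hc : c ∈ cocycles 0 L K)
    (hK : ∀ γ : Gamma0 L, (∀ i j, ((gmat γ i j : ℤ) : ZMod n) = (((1 : Matrix (Fin 2) (Fin 2) ℤ) i j : ℤ) : ZMod n)) →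
      c γ = 0)
    (hrL : ¬ r ∣ L) (hrn : r ≡ 1 [MOD n]) : heckeU 0 L K hr c = ((r : K) + 1) • c := by
  classical
  let U : Option (ZMod r) → Gamma0 L := fun o ↦ Option.elim o (1 : Gamma0 L) fun j ↦ ⟨T ^ (j.val : ℤ), T_zpow_mem_Gamma0 L _⟩
  let red : Matrix (Fin 2) (Fin 2) ℤ →+* Matrix (Fin 2) (Fin 2) (ZMod n) := (Int.castRingHom (ZMod n)).mapMatrix
  have hred : ∀ A : Matrix (Fin 2) (Fin 2) ℤ, red A = A.map (Int.castRingHom (ZMod n)) := fun A ↦ rfl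
  have hU : ∀ o, red (heckeRep r o) = red (gmat (U o)) := by
    intro o
    rw [hred, hred]
    exact heckeRep_map_eq_of_modEq L hrn o
  funext γ
  -- each term of the Hecke sum
  have hterm : ∀ i : HeckeIdx L r,
      c (heckePermElt hr γ i) = c (U i.1) + c γ - c (U (heckePerm hr γ i).1) := by
    intro i
    have hW : c (heckePermElt hr γ i) = c (U i.1 * γ * (U (heckePerm hr γ i).1)⁻¹) := by
      apply congr_of_kills_principalCongruence hc hK
      intro a b
      have hspec := heckePermElt_spec hr γ i
      have h1 : red (gmat (heckePermElt hr γ i)) * red (gmat (U (heckePerm hr γ i).1)) = red (gmat (U i.1)) * red (gmat γ) := by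
        rw [← hU, ← hU, ← map_mul, ← map_mul]
        exact congrArg red hspec
      have h2 : red (gmat (heckePermElt hr γ i)) = red (gmat (U i.1 * γ * (U (heckePerm hr γ i).1)⁻¹)) := by
        rw [gmat_mul, gmat_mul, map_mul, map_mul, ← h1, mul_assoc, ← map_mul, ← gmat_mul, mul_inv_cancel, gmat_one,
          map_one, mul_one]
      exact congrFun (congrFun h2 a) b
    rw [hW, cocycle_zero_mul hc, cocycle_zero_mul hc, cocycle_zero_inv hc]
    abel
  rw [heckeU_apply]
  simp only [act_zero_eq_id, LinearMap.id_apply, Pi.smul_apply]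
  rw [Finset.sum_congr rfl fun i _ ↦ hterm i, Finset.sum_sub_distrib, Finset.sum_add_distrib]
  have hsum : ∑ i : HeckeIdx L r, c (U (heckePerm hr γ i).1) = ∑ i : HeckeIdx L r, c (U i.1) :=
    Equiv.sum_comp (heckePermEquiv hr γ) (fun i ↦ c (U i.1))
  rw [hsum, add_sub_cancel_left, Finset.sum_const, Finset.card_univ, card_heckeIdx hrL, ← Nat.cast_smul_eq_nsmul K]
  push_cast
  rfl

/-- **LEMMA C, E-es-39 `HeckeOnCongruenceCharacter t` — the es sketch's statement verbatim** (HOME/es/Sketch-es-g12.lean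
`EsG12.HeckeOnCongruenceCharacter`): for a homomorphism `c : Γ₀(L) → K` killing `Γ₀(L) ∩ Γ(t^M)` and a prime `r ∤ tL` with
`r ≡ 1 (mod t^M)`, `T_r c = (r + 1)·c`. [cite: Shimura1971, §8.3 (8.3.2)] -/
theorem heckeOnCongruenceCharacter (t : ℕ) :
    ∀ (K : Type) [Field K] (L M : ℕ) [NeZero L] (c : cocycles 0 L K),
      (∀ γ : Gamma0 L, (∀ i j : Fin 2, ((t : ℤ) ^ M) ∣ ((γ : SL(2, ℤ)) i j - (1 : SL(2, ℤ)) i j)) →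
        (c : Gamma0 L → Fin 1 → K) γ = 0) →
      ∀ (r : ℕ) [NeZero r] (hr : r.Prime), ¬ r ∣ L → ¬ r ∣ t → r ≡ 1 [MOD t ^ M] →
        heckeU 0 L K hr (c : Gamma0 L → Fin 1 → K) = ((r : K) + 1) • (c : Gamma0 L → Fin 1 → K) := by
  intro K _ L M _ c hc r _ hr hrL hrt hrM
  have ht : t ≠ 0 := by rintro rfl; exact hrt (dvd_zero r)
  haveI : NeZero (t ^ M) := ⟨pow_ne_zero M ht⟩
  refine heckeU_eq_smul_of_kills_congruence hr c.2 (fun γ hγ ↦ hc γ fun i j ↦ ?_) hrL hrM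
  have h := (ZMod.intCast_eq_intCast_iff_dvd_sub _ _ (t ^ M)).mp (hγ i j).symm
  rw [Nat.cast_pow] at h
  rw [Matrix.SpecialLinearGroup.coe_one]
  exact h

end LemmaC

end Summit.BirchSwinnertonDyer.BirchSwinnertonDyer.Theorems.ManinLocalTwoThree
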